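import Literature.NumberTheory.Sieve.HeathBrownCubicTypeII
import HarnessLib

/-!
# Heath-Brown's Lemma 3.9 (the leading parts): the two halves (10.4) and (10.5) of its proof

Ninth layer of the decomposition of **parity.S18**
(`Literature.NumberTheory.Sieve.setOf_prime_cube_add_two_mul_cube_infinite`) along D. R. Heath-Brown,
*Primes represented by `x³ + 2y³`*, Acta Math. 186 (2001), 1–84. The layer `HeathBrownCubicTypeII`
vendors **Lemma 3.9** (p. 19) as the named fact `HeathBrown2001_lemma_3_9`: for every bilinear sum
`U = ∑_R c_R ∑_{S : RS ∈ ·} d_S` of the form (3.3),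
`U_e(𝒜) − κU(ℬ) ≪ M^{-1} η^{5/2} X² (log X)^c`, `M = ∏ m_i`, `κ = σ₀η(3X)^{-1}`.
Its proof is §10 of the paper (pp. 60–66). It has two independent halves, which meet only in the
common leading term (p. 64)

  `Σ₃ = ∑_R c_R · w'(3X³/N(R)) / (M (ξ log X)^{n+1} N(R))`:

* the `𝒜`-side, display **(10.4)** (p. 64): `U_e(𝒜) = σ₀η²X²Σ₃ + O(M^{-1}η^{5/2}X²(log X)^c)`,
  obtained from the Type I bound Lemma 3.2 at level `X^{2−τ/2}`, the evaluation
  `Σ₁ = ∑_{J ∈ 𝒯r, N(J) < L} μ(J)ρ₂(J)N(J)^{-1} log(L/N(J)) = π²σ₀/6 + O(exp(−c√(log L)))` by Perron's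
  formula and the zero-free region of `ζ_K` (pp. 62–63), the Lipschitz property (8.3) of `w'`, and
  divisor-sum bounds (Lemmas 4.2, 4.7) for the errors (10.1), (10.2);
* the `ℬ`-side, display **(10.5)** (p. 65, and p. 66 for `n = 0`): `U(ℬ) = 3ηX³Σ₃ + O(η²M^{-1}X³)`,
  obtained from the prime ideal theorem in the form of Lemma 4.10, the mean value theorem with
  (8.3), and (for `n = 0`) Weber's ideal count, Lemma 4.1.

"A comparison of (10.4) and (10.5) then establishes the first part of Lemma 3.9" (p. 65), because
`κ · 3ηX³ = σ₀η²X²` exactly. This file defines the common leading term `Σ₃` and PROVES that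
comparison: Lemma 3.9 follows from the two displays, which enter as explicit hypotheses `h4`, `h5`
of `HeathBrown2001_lemma_3_9_of_displays` (they are NOT vendored as named facts — D-0026: the
proofs of (10.4) and (10.5) from Lemma 3.2, Lemma 4.10 / the prime ideal theorem, the `w`-calculus
(8.3)–(8.4) and the `Σ₁`-evaluation are to be supplied as theorems by the sequel files, at which
point `HeathBrown2001_lemma_3_9_holds` is `HeathBrown2001_lemma_3_9_of_displays d4 d5`). Harman,
*Prime-Detecting Sieves*, §13.7 prints the same two displays as (13.7.1), (13.7.2) and the same
closing sentence.

## Content (namespace `Literature.NumberTheory.Sieve.CubicSieve`)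

* `sigma3 X τ 𝐦 c` — the common leading term `Σ₃` (p. 64), as a finite sum (see below);
  `sigma3_summand_eq_zero` (terms with `N(R) > 3X³` vanish, justifying the truncation).
* `kappa_mul_main`, `abs_kappa` — `κ · 3ηX³ = σ₀η²X²`, `|κ| = |σ₀|η/(3X)` (`κ = σ₀η(3X)^{-1}`, p. 5).
* **`HeathBrown2001_lemma_3_9_of_displays (h4 : (10.4)) (h5 : (10.5)) : HeathBrown2001_lemma_3_9`**
  (p. 65: `|U_e(𝒜) − κU(ℬ)| ≤ |U_e(𝒜) − σ₀η²X²Σ₃| + κ|3ηX³Σ₃ − U(ℬ)| ≪ M^{-1}(η^{5/2}(log X)^c + σ₀η³)X²`),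
  the hypotheses being the displays (10.4), (10.5) in the standing set-up of Lemma 3.9, written
  out with the quantifier prefix of `HeathBrown2001_lemma_3_9` (see the docstring).

## Faithfulness / modelling notes

* `Σ₃` is printed (p. 64) as a sum over all ideals `R`. Only `R` with `c_R w'(3X³/N(R)) ≠ 0`
  contribute, and `w'(t, 𝐦) = 0` for `t < X^{ξ∑m_i}` (`wDeriv_eq_zero`), in particular for
  `t < 1` once `X ≥ 1` and `τ > 0`; so the sum may be truncated at `N(R) ≤ 3X³` without change
  (`sigma3_summand_eq_zero`). We DEFINE `Σ₃` as that finite sum over `idealsLE ⌊3X³⌋`.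
* (10.4), (10.5) are `O`-statements inside a proof, in the standing set-up of §3: `τ = (log log X)^{−ϖ}`
  with `0 < ϖ < 1/5` ((2.5), (3.10)), `ξ = τ⁵` ((3.9)), `L = X^{τ/2}` ((3.13)), `η` in the range (2.1)
  `exp(−(log X)^{1/3}) ≤ η ≤ 1`, `X` large, `𝐦` satisfying (3.5)–(3.7), `c_R` as in (3.3), the exponent
  `c` and the implied constants absolute. As hypotheses `h4`, `h5` they are written with the quantifier
  prefix of `HeathBrown2001_lemma_3_9` (constants may depend on `ϖ`, and on `σ₀` in (10.4)) — the
  weaker form, which is all the comparison needs.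
* (10.5) is displayed on p. 65 for `n ≥ 1`, "`= 3ηX³Σ₃ + O(η²M^{-1}X³)`, by (2.1)"; for `n = 0`, p. 66
  arrives at "`U(ℬ) = ∑_R c_R (3ηX³/(Mξ log X N(R))) w'(3X³/N(R)) + O(η²X³M^{-1})`", the same
  statement ("and the first part of Lemma 3.9 follows as in the case `n ≥ 1`"). Likewise (10.4) is
  reached for all `n ≥ 0` (the case `n = 0` enters through (10.2), p. 61). Both hypotheses are
  therefore stated for admissible vectors `𝐦` of every length `k = n + 1`, as Lemma 3.9 is.
* `σ₀` enters (10.4) as on p. 63 ("where `σ₀` is … as usual", the singular series of the Theorem,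
  p. 2); as in `HeathBrown2001_lemma_3_9` it is introduced as the limit of the ordered partial products
  `singularProductPartial` (unique; it exists and is positive by `HeathBrown2001_singularProduct_holds`).
* The second part of Lemma 3.9 (the sums over `n`, `𝐦`) is derived in `HeathBrownCubicTypeIIProofs`
  and is not touched here.

## References

* D. R. Heath-Brown, *Primes represented by `x³ + 2y³`*, Acta Math. 186 (2001), 1–84: Lemma 3.9
  (p. 19) and §10, pp. 60–66, displays (10.1)–(10.5). [cite: HeathBrownActa2001, §10 pp. 60–66]
* G. Harman, *Prime-Detecting Sieves*, LMS Monographs 33 (2007), §13.2 Lemma 13.7 (`= Lemma 3.9`) and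
  §13.7, (13.7.1)–(13.7.2), p. 278. [cite: Harman2007, §13.7]

## Mathlib / tree search

Nothing number-theoretic is needed here beyond the previous layers: `HeathBrownCubicTypeII` (`bilin`,
`dWeight`, `eWeight`, `wDeriv`, `wDeriv_eq_zero`, `CoreAdmissible`, `CSupport`, `hbXi`,
`HeathBrown2001_lemma_3_9`), `HeathBrownCubicSieveDecomposition` (`hbTau`), `HeathBrownCubicSieveSetup`
(`idealsLE`, `boxPairs`, `pairIdeal`, `normWindow`), `HeathBrownCubicPrimesOutline` (`kappa`),
`HeathBrownCubicPrimes` (`singularProductPartial`). Mathlib: `Real.rpow_le_rpow_of_exponent_ge`,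
`Real.rpow_le_rpow_of_exponent_le`, `Real.one_le_rpow`, `Real.rpow_natCast`. Searched the tree for an
existing leading-term object (`sigma3`, `Sigma3`, `leadingTerm` in `Sieve/HeathBrownCubic*`): none.
-/

noncomputable section

open Polynomial NumberField Finset Filter Topology

namespace Literature.NumberTheory.Sieve.CubicSieve

open LFunctions.CubeRootTwoField CubicPrimes

/-! ### The common leading term `Σ₃` (p. 64) -/

open scoped Classical in
/-- **`Σ₃ = ∑_R c_R · w'(3X³/N(R)) / (M (ξ log X)^{n+1} N(R))`** (p. 64), the common leading term of
`U_e(𝒜)` ((10.4)) and `U(ℬ)` ((10.5)); here `M (ξ log X)^{n+1} = ∏_{i=1}^{n+1} (m_i ξ log X)` and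
`w' = w'(·, 𝐦)` is the (right-hand) derivative of `w(t, 𝐦)` ((3.12)). The printed sum is over all
ideals `R`; as `w'(t, 𝐦) = 0` for `t < X^{ξ∑m_i}` it is supported on `N(R) ≤ 3X³` (for `X ≥ 1`,
`τ > 0`; `sigma3_summand_eq_zero`), and we define it as the finite sum over those `R`.
[cite: HeathBrownActa2001, §10 p. 64] -/
def sigma3 (X τ : ℝ) {k : ℕ} (m : Fin k → ℕ) (c : Ideal (𝓞 K) → ℝ) : ℝ :=
  ∑ R ∈ idealsLE ⌊3 * X ^ 3⌋₊,
    c R * wDeriv X τ m (3 * X ^ 3 / Ideal.absNorm R) /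
      ((∏ i, ((m i : ℝ) * hbXi τ * Real.log X)) * Ideal.absNorm R)

/-- The truncation in `sigma3` is harmless: for `X ≥ 1`, `τ > 0` and `N(R) > 3X³` one has
`3X³/N(R) < 1 ≤ X^{ξ∑m_i}`, so `w'(3X³/N(R), 𝐦) = 0` (`wDeriv_eq_zero`) and the summand of `Σ₃` at
`R` vanishes. [cite: HeathBrownActa2001, §10 p. 64] -/
theorem sigma3_summand_eq_zero {X τ : ℝ} (hX : 1 ≤ X) (hτ : 0 < τ) {k : ℕ} (m : Fin k → ℕ)
    (c : Ideal (𝓞 K) → ℝ) {R : Ideal (𝓞 K)} (hR : 3 * X ^ 3 < (Ideal.absNorm R : ℝ)) :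
    c R * wDeriv X τ m (3 * X ^ 3 / Ideal.absNorm R) /
      ((∏ i, ((m i : ℝ) * hbXi τ * Real.log X)) * Ideal.absNorm R) = 0 := by
  have hX0 : 0 < X := by linarith
  have hN : 0 < (Ideal.absNorm R : ℝ) := lt_trans (by positivity) hR
  have hlt : 3 * X ^ 3 / (Ideal.absNorm R : ℝ) < X ^ (hbXi τ * ∑ i, (m i : ℝ)) := by
    calc 3 * X ^ 3 / (Ideal.absNorm R : ℝ) < 1 := (div_lt_one hN).mpr hR
      _ ≤ X ^ (hbXi τ * ∑ i, (m i : ℝ)) :=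
        Real.one_le_rpow hX (mul_nonneg (hbXi_pos hτ).le (sum_nonneg fun i _ => by positivity))
  rw [wDeriv_eq_zero hX0 m (Or.inl hlt), mul_zero, zero_div]

/-! ### Lemma 3.9 from (10.4) and (10.5) -/

/-- `κ · 3ηX³ = σ₀η²X²` for `X ≠ 0` (`κ = σ₀η(3X)^{-1}`, p. 5): the leading terms of (10.4) and
`κ`·(10.5) agree exactly. [cite: HeathBrownActa2001, §2 (2.4)] -/
theorem kappa_mul_main (σ₀ η : ℝ) {X : ℝ} (hX : X ≠ 0) :
    kappa σ₀ X η * (3 * η * X ^ 3) = σ₀ * η ^ 2 * X ^ 2 := by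
  rw [kappa]
  field_simp

/-- `|κ| = |σ₀| η / (3X)` for `η ≥ 0`, `X > 0`. [cite: HeathBrownActa2001, §2 (2.4)] -/
theorem abs_kappa (σ₀ : ℝ) {X η : ℝ} (hX : 0 < X) (hη : 0 ≤ η) :
    |kappa σ₀ X η| = |σ₀| * η / (3 * X) := by
  rw [kappa, abs_div, abs_mul, abs_of_nonneg hη, abs_of_pos (by positivity : (0 : ℝ) < 3 * X)]

/-- **Heath-Brown's Lemma 3.9 from the two halves (10.4), (10.5) of its proof** ("A comparison of
(10.4) and (10.5) then establishes the first part of Lemma 3.9", p. 65; Harman (13.7.1)–(13.7.2)).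
The hypotheses are the two displays, in the standing set-up and with the quantifier prefix of
`HeathBrown2001_lemma_3_9`:

* `h4` = **(10.4)** (p. 64): "`U_e(𝒜) = σ₀η²X²Σ₃ + O(M^{-1}η^{5/2}X²(log X)^c)`", where
  `U_e(𝒜) = ∑_R c_R ∑_{RS ∈ 𝒜^(K)} e_S` is the leading part of the bilinear sum (3.3) (p. 19),
  `Σ₃` is `sigma3`, `M = ∏ m_i`, `σ₀` the singular series; derived on pp. 60–64 from Lemma 3.2 at
  level `X^{2−τ/2}`, the errors (10.1)–(10.2) of replacing `N(S)` by `3X³/N(R)` in `w'(N(S))` ((8.3),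
  Lemmas 4.2, 4.7), the evaluation `Σ₁ = π²σ₀/6 + O(exp(−c√(log L)))` (Perron's formula and the
  zero-free region of `ζ_K`, pp. 62–63), `ρ₂(R) = 1 + O(τ^{-1}X^{-τ})` and `Σ₃ ≪ M^{-1} log X` ((8.4));
* `h5` = **(10.5)** (p. 65; p. 66 for `n = 0`): "`U(ℬ) = 3ηX³Σ₃ + O(η²M^{-1}X³)`", where
  `U(ℬ) = ∑_R c_R ∑_{RS ∈ ℬ^(K)} d_S`; derived from the prime ideal theorem in the form of Lemma 4.10
  (`ϱ = X^ξ`, `Δ = L`), (9.5), the mean value theorem with (8.3), and Lemma 4.1 for the edge terms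
  when `n = 0`.

Proof: since `κ · 3ηX³ = σ₀η²X²`, `U_e(𝒜) − κU(ℬ) = [U_e(𝒜) − σ₀η²X²Σ₃] + κ[3ηX³Σ₃ − U(ℬ)]`, so
`|U_e(𝒜) − κU(ℬ)| ≤ C₄M^{-1}η^{5/2}X²(log X)^{c} + (|σ₀|η/3X)·|C₅|η²M^{-1}X³ ≤ (C₄ + |σ₀C₅|/3) M^{-1}η^{5/2}X²(log X)^{c}`
for `X ≥ e` (`η³ ≤ η^{5/2}` as `0 < η ≤ 1`, `(log X)^c ≥ 1` for `c ≥ 0`).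
[cite: HeathBrownActa2001, Lemma 3.9 and §10 (10.4)–(10.5)] -/
theorem HeathBrown2001_lemma_3_9_of_displays
    (h4 : ∀ σ₀ : ℝ, Tendsto singularProductPartial atTop (𝓝 σ₀) →
      ∀ ϖ : ℝ, 0 < ϖ → ϖ < 1 / 5 →
        ∃ c C X₀ : ℝ, ∀ X η : ℝ, X₀ ≤ X → Real.exp (-Real.log X ^ (1 / 3 : ℝ)) ≤ η → η ≤ 1 →
          ∀ (k : ℕ) (m : Fin k → ℕ), CoreAdmissible (hbTau ϖ X) m →
            ∀ cR : Ideal (𝓞 K) → ℝ, CSupport X (hbTau ϖ X) cR →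
              |bilin (boxPairs X η) pairIdeal cR (eWeight X (hbTau ϖ X) m) -
                  σ₀ * η ^ 2 * X ^ 2 * sigma3 X (hbTau ϖ X) m cR| ≤
                C * (∏ i, (m i : ℝ))⁻¹ * η ^ (5 / 2 : ℝ) * X ^ 2 * Real.log X ^ c)
    (h5 : ∀ ϖ : ℝ, 0 < ϖ → ϖ < 1 / 5 →
      ∃ C X₀ : ℝ, ∀ X η : ℝ, X₀ ≤ X → Real.exp (-Real.log X ^ (1 / 3 : ℝ)) ≤ η → η ≤ 1 →
        ∀ (k : ℕ) (m : Fin k → ℕ), CoreAdmissible (hbTau ϖ X) m →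
          ∀ cR : Ideal (𝓞 K) → ℝ, CSupport X (hbTau ϖ X) cR →
            |bilin (normWindow X η) (fun J => J) cR (dWeight X (hbTau ϖ X) m) -
                3 * η * X ^ 3 * sigma3 X (hbTau ϖ X) m cR| ≤
              C * (∏ i, (m i : ℝ))⁻¹ * η ^ 2 * X ^ 3) :
    HeathBrown2001_lemma_3_9 := by
  intro σ₀ hσ ϖ hϖ0 hϖ5
  obtain ⟨c₄, C₄, X₄, H4⟩ := h4 σ₀ hσ ϖ hϖ0 hϖ5
  obtain ⟨C₅, X₅, H5⟩ := h5 ϖ hϖ0 hϖ5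
  refine ⟨max c₄ 0, max C₄ 0 + |σ₀| * |C₅| / 3, max (max X₄ X₅) (Real.exp 1), ?_⟩
  intro X η hX hη1 hη2 k m hm cR hc
  have hX4 : X₄ ≤ X := le_trans ((le_max_left _ _).trans (le_max_left _ _)) hX
  have hX5 : X₅ ≤ X := le_trans ((le_max_right _ _).trans (le_max_left _ _)) hX
  have hXe : Real.exp 1 ≤ X := (le_max_right _ _).trans hX
  have hX0 : 0 < X := (Real.exp_pos 1).trans_le hXe
  have hlog : 1 ≤ Real.log X := by
    rw [← Real.log_exp 1]; exact Real.log_le_log (Real.exp_pos 1) hXe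
  have hη0 : 0 < η := (Real.exp_pos _).trans_le hη1
  have H4' := H4 X η hX4 hη1 hη2 k m hm cR hc
  have H5' := H5 X η hX5 hη1 hη2 k m hm cR hc
  set Ue := bilin (boxPairs X η) pairIdeal cR (eWeight X (hbTau ϖ X) m) with hUe
  set Ub := bilin (normWindow X η) (fun J => J) cR (dWeight X (hbTau ϖ X) m) with hUb
  set S3 := sigma3 X (hbTau ϖ X) m cR with hS3
  set Minv : ℝ := (∏ i, (m i : ℝ))⁻¹ with hMinv_def
  have hMinv : 0 ≤ Minv := inv_nonneg.mpr (prod_nonneg fun i _ => Nat.cast_nonneg _)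
  have hk := kappa_mul_main σ₀ η hX0.ne'
  -- the decomposition of `U_e(𝒜) − κU(ℬ)`
  have hsplit : Ue - kappa σ₀ X η * Ub =
      (Ue - σ₀ * η ^ 2 * X ^ 2 * S3) + kappa σ₀ X η * (3 * η * X ^ 3 * S3 - Ub) := by
    linear_combination (-S3) * hk
  -- the two error terms
  have hc0 : (0 : ℝ) ≤ max c₄ 0 := le_max_right _ _
  have hlogc : 1 ≤ Real.log X ^ (max c₄ 0) := Real.one_le_rpow hlog hc0
  have hlogmono : Real.log X ^ c₄ ≤ Real.log X ^ (max c₄ 0) :=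
    Real.rpow_le_rpow_of_exponent_le hlog (le_max_left _ _)
  have hη52 : 0 ≤ η ^ (5 / 2 : ℝ) := Real.rpow_nonneg hη0.le _
  have hη3 : η ^ 3 ≤ η ^ (5 / 2 : ℝ) := by
    calc η ^ 3 = η ^ ((3 : ℕ) : ℝ) := (Real.rpow_natCast η 3).symm
      _ ≤ η ^ (5 / 2 : ℝ) := Real.rpow_le_rpow_of_exponent_ge hη0 hη2 (by norm_num)
  have hbase : 0 ≤ Minv * η ^ (5 / 2 : ℝ) * X ^ 2 * Real.log X ^ (max c₄ 0) := by positivity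
  -- first term
  have h1 : |Ue - σ₀ * η ^ 2 * X ^ 2 * S3| ≤
      max C₄ 0 * (Minv * η ^ (5 / 2 : ℝ) * X ^ 2 * Real.log X ^ (max c₄ 0)) := by
    calc |Ue - σ₀ * η ^ 2 * X ^ 2 * S3|
        ≤ C₄ * Minv * η ^ (5 / 2 : ℝ) * X ^ 2 * Real.log X ^ c₄ := H4'
      _ = C₄ * (Minv * η ^ (5 / 2 : ℝ) * X ^ 2 * Real.log X ^ c₄) := by ring
      _ ≤ max C₄ 0 * (Minv * η ^ (5 / 2 : ℝ) * X ^ 2 * Real.log X ^ c₄) :=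
          mul_le_mul_of_nonneg_right (le_max_left _ _) (by positivity)
      _ ≤ max C₄ 0 * (Minv * η ^ (5 / 2 : ℝ) * X ^ 2 * Real.log X ^ (max c₄ 0)) :=
          mul_le_mul_of_nonneg_left
            (mul_le_mul_of_nonneg_left hlogmono (by positivity)) (le_max_right _ _)
  -- second term
  have h2 : |kappa σ₀ X η * (3 * η * X ^ 3 * S3 - Ub)| ≤
      |σ₀| * |C₅| / 3 * (Minv * η ^ (5 / 2 : ℝ) * X ^ 2 * Real.log X ^ (max c₄ 0)) := by
    rw [abs_mul, abs_kappa σ₀ hX0 hη0.le, abs_sub_comm]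
    calc |σ₀| * η / (3 * X) * |Ub - 3 * η * X ^ 3 * S3|
        ≤ |σ₀| * η / (3 * X) * (|C₅| * Minv * η ^ 2 * X ^ 3) := by
          refine mul_le_mul_of_nonneg_left (H5'.trans ?_) (by positivity)
          have h1 : C₅ * Minv * η ^ 2 * X ^ 3 = C₅ * (Minv * η ^ 2 * X ^ 3) := by ring
          have h2 : |C₅| * Minv * η ^ 2 * X ^ 3 = |C₅| * (Minv * η ^ 2 * X ^ 3) := by ring
          rw [h1, h2]
          exact mul_le_mul_of_nonneg_right (le_abs_self C₅) (by positivity)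
      _ = |σ₀| * |C₅| / 3 * (Minv * η ^ 3 * X ^ 2) := by
          field_simp
      _ ≤ |σ₀| * |C₅| / 3 * (Minv * η ^ (5 / 2 : ℝ) * X ^ 2 * Real.log X ^ (max c₄ 0)) := by
          refine mul_le_mul_of_nonneg_left ?_ (by positivity)
          calc Minv * η ^ 3 * X ^ 2 ≤ Minv * η ^ (5 / 2 : ℝ) * X ^ 2 :=
                mul_le_mul_of_nonneg_right (mul_le_mul_of_nonneg_left hη3 hMinv) (by positivity)
            _ = Minv * η ^ (5 / 2 : ℝ) * X ^ 2 * 1 := (mul_one _).symm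
            _ ≤ Minv * η ^ (5 / 2 : ℝ) * X ^ 2 * Real.log X ^ (max c₄ 0) :=
                mul_le_mul_of_nonneg_left hlogc (by positivity)
  -- assemble
  calc |Ue - kappa σ₀ X η * Ub|
      = |(Ue - σ₀ * η ^ 2 * X ^ 2 * S3) + kappa σ₀ X η * (3 * η * X ^ 3 * S3 - Ub)| := by
        rw [hsplit]
    _ ≤ |Ue - σ₀ * η ^ 2 * X ^ 2 * S3| + |kappa σ₀ X η * (3 * η * X ^ 3 * S3 - Ub)| :=
        abs_add_le _ _
    _ ≤ max C₄ 0 * (Minv * η ^ (5 / 2 : ℝ) * X ^ 2 * Real.log X ^ (max c₄ 0)) +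
          |σ₀| * |C₅| / 3 * (Minv * η ^ (5 / 2 : ℝ) * X ^ 2 * Real.log X ^ (max c₄ 0)) :=
        add_le_add h1 h2
    _ = (max C₄ 0 + |σ₀| * |C₅| / 3) * Minv * η ^ (5 / 2 : ℝ) * X ^ 2 *
          Real.log X ^ (max c₄ 0) := by ring

end Literature.NumberTheory.Sieve.CubicSieve

end
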